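import Mathlib
import Summits.Ventures.HodgeRepro2.T5HeckePermutationModule
import Summits.Ventures.HodgeRepro2.T5LevelIdempotent
import Summits.Ventures.HodgeRepro2.T5HeckeOperator

/-!
# Double cosets in `H(G, K) = End_G(k[G ⧸ K])` and the operator `e_K ρ(g) e_K`

Blind cell `pub-hodge-repro2`, seat p8 (gen 8), Tier-5 kernel support.  `T5HeckePermutationModule`
(T5-52) records the Hecke algebra `H(G, K)` without Haar measure as `End_G(k[G ⧸ K])` and its
action on `V^K`; `T5HeckeOperator` (T5-46) records the operators `e_K ρ(g) e_K` on `V^K` built from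
the level idempotent `e_K` of `T5LevelIdempotent` (T5-35).  This file identifies the two:

* `stabilizer_coset_eq` — the stabiliser in `K` of the coset `gK` is `K ∩ gKg⁻¹`
  (`mem_stabilizer_coset_iff`: `g⁻¹ κ g ∈ K`);
* `finite_orbit_coset_of_isOpen_of_isCompact` — for `K` compact open in a topological group the
  `K`-orbit of `gK` is finite: every double coset `KgK` is a finite union of left cosets
  (`finiteIndex_stabilizer_coset`: `[K : K ∩ gKg⁻¹] < ∞`);
* `orbitVector k K O := ∑ᶠ x ∈ O, single x 1` — the sum of the basis vectors over a set of cosets;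
  for the `K`-orbit of `gK` it is `K`-fixed (`orbitVector_orbit_mem_invariants`);
* `doubleCosetOp k K g : heckeAlgebra k K` — the DOUBLE-COSET ELEMENT `T_g = 1_{KgK}` of the Hecke
  algebra (Frobenius reciprocity applied to the orbit vector); `doubleCosetOp_mul_mul` (it depends
  on `KgK` only), `doubleCosetOp_of_mem` (`T_g = 1` for `g ∈ K`);
* `heckeSMul_doubleCosetOp` — `T_g • v = ∑_{x ∈ KgK/K} ρ(x) v` on `V^K`;
* `heckeOp_eq_inv_index_smul` / `heckeOp_eq_inv_ncard_smul` / `coe_heckeOp_eq_finsum` — THE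
  IDENTIFICATION `e_K ρ(g) e_K = [K : K ∩ gKg⁻¹]⁻¹ · T_g = #(KgK/K)⁻¹ · T_g` on `V^K`
  (characteristic `0`, `ρ` `K`-finite): the operator of T5-46 is the double-coset element of
  T5-52 with the Haar-free normalisation `vol(KgK)/vol(K) = #(KgK/K)`.

In the record: the printed `T_g = vol(K)⁻¹ 1_{KgK}` acting on `π^K` by convolution is, after the
identification of convolution by `vol(K)⁻¹ 1_K` with `e_K` (the remaining prose of T5-35), the
operator `#(KgK/K) · e_K π(g) e_K` of this file.  What stays prose: the Haar measure itself and the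
identification of the product of `H(G, K)` with convolution.

README §8(d): uses an L-value-free non-vanishing device: NO.
-/

namespace Summit.Ventures.HodgeRepro2.T5HeckeDoubleCoset

noncomputable section

open Summit.Ventures.HodgeRepro2.LevelPositivity
open Summit.Ventures.HodgeRepro2.T5HeckePermutationModule
open Summit.Ventures.HodgeRepro2.T5LevelIdempotent
open Summit.Ventures.HodgeRepro2.T5HeckeOperator
open MonoidAlgebra Representation MulAction
open scoped Pointwise

variable {G : Type*} [Group G] {k : Type*} [Field k] {V : Type*} [AddCommGroup V] [Module k V]

section Stabilizer

variable (K : Subgroup G) (g : G)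

/-- The stabiliser in `K` of the coset `gK` is `K ∩ gKg⁻¹`, as a subgroup of `K`. -/
theorem stabilizer_coset_eq :
    stabilizer K (g : G ⧸ K) = (Subgroup.map (MulAut.conj g).toMonoidHom K).subgroupOf K := by
  ext κ
  rw [MulAction.mem_stabilizer_iff, Subgroup.mem_subgroupOf, Subgroup.mem_map_equiv,
    MulAut.conj_symm_apply]
  change (((κ : G) * g : G) : G ⧸ K) = (g : G ⧸ K) ↔ _
  rw [QuotientGroup.eq]
  have : ((κ : G) * g)⁻¹ * g = (g⁻¹ * κ * g)⁻¹ := by group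
  rw [this, Subgroup.inv_mem_iff]

/-- `κ ∈ K` stabilises `gK` iff `g⁻¹ κ g ∈ K`. -/
theorem mem_stabilizer_coset_iff {κ : K} : κ ∈ stabilizer K (g : G ⧸ K) ↔ g⁻¹ * κ * g ∈ K := by
  rw [stabilizer_coset_eq, Subgroup.mem_subgroupOf, Subgroup.mem_map_equiv, MulAut.conj_symm_apply]

/-- The stabiliser of `gK` in `K` fixes `ρ g v` for every `K`-fixed vector `v`. -/
theorem stabilizer_coset_le_stabilizerIn (ρ : Representation k G V) {v : V}
    (hv : v ∈ invariants ρ K) :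
    stabilizer K (g : G ⧸ K) ≤ stabilizerIn ρ K (ρ g v) := by
  intro κ hκ
  rw [mem_stabilizer_coset_iff] at hκ
  rw [mem_stabilizerIn_iff]
  have : ρ κ (ρ g v) = ρ g (ρ (g⁻¹ * κ * g) v) := by
    rw [← Module.End.mul_apply, ← Module.End.mul_apply, ← map_mul, ← map_mul]
    congr 2
    group
  rw [this, mem_invariants_iff.mp hv _ hκ]

/-- A finite `K`-orbit of `gK` means `[K : K ∩ gKg⁻¹] < ∞`. -/
theorem finiteIndex_stabilizer_coset [Finite (orbit K (g : G ⧸ K))] :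
    (stabilizer K (g : G ⧸ K)).FiniteIndex := by
  haveI : Finite (K ⧸ stabilizer K (g : G ⧸ K)) :=
    Finite.of_equiv _ (orbitEquivQuotientStabilizer K (g : G ⧸ K))
  exact Subgroup.finiteIndex_of_finite_quotient

/-- `[K : K ∩ gKg⁻¹] < ∞` means the `K`-orbit of `gK` is finite. -/
theorem finite_orbit_coset_of_finiteIndex [(stabilizer K (g : G ⧸ K)).FiniteIndex] :
    Finite (orbit K (g : G ⧸ K)) :=
  Finite.of_equiv _ (orbitEquivQuotientStabilizer K (g : G ⧸ K)).symm

/-- For `K` compact open in a topological group, every double coset `KgK` is a finite union of left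
cosets: the `K`-orbit of `gK` is finite. -/
theorem finite_orbit_coset_of_isOpen_of_isCompact [TopologicalSpace G] [IsTopologicalGroup G]
    (hKo : IsOpen (K : Set G)) (hKc : IsCompact (K : Set G)) : Finite (orbit K (g : G ⧸ K)) := by
  haveI : CompactSpace K := isCompact_iff_compactSpace.mp hKc
  have hS : IsOpen ((stabilizer K (g : G ⧸ K) : Subgroup K) : Set K) := by
    have : ((stabilizer K (g : G ⧸ K) : Subgroup K) : Set K) =
        (fun κ : K => g⁻¹ * (κ : G) * g) ⁻¹' (K : Set G) := by
      ext κ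
      exact mem_stabilizer_coset_iff K g
    rw [this]
    exact hKo.preimage (by fun_prop)
  haveI : Finite (K ⧸ stabilizer K (g : G ⧸ K)) := Subgroup.quotient_finite_of_isOpen _ hS
  exact Finite.of_equiv _ (orbitEquivQuotientStabilizer K (g : G ⧸ K)).symm

end Stabilizer

section OrbitVector

variable (k) (K : Subgroup G)

/-- The sum of the basis vectors of `k[G ⧸ K]` over a set `O` of cosets (the indicator function of
`O`; `0` if `O` is infinite). -/
def orbitVector (O : Set (G ⧸ K)) : MonoidAlgebra k (G ⧸ K) := ∑ᶠ x ∈ O, single x 1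

/-- The orbit vector of a single coset. -/
theorem orbitVector_singleton (x : G ⧸ K) : orbitVector k K {x} = single x 1 :=
  finsum_mem_singleton

/-- The permutation action moves the orbit vector of `O` to that of `g • O`. -/
theorem ofMulAction_orbitVector {O : Set (G ⧸ K)} (hO : O.Finite) (g : G) :
    ofMulAction k G (G ⧸ K) g (orbitVector k K O) = orbitVector k K (g • O) := by
  unfold orbitVector
  rw [finsum_mem_eq_finite_toFinset_sum _ hO, map_sum,
    finsum_mem_eq_finite_toFinset_sum _ (hO.smul_set (a := g))]
  simp only [ofMulAction_single]
  refine Finset.sum_equiv (MulAction.toPerm g) (fun x => ?_) (fun x _ => rfl)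
  simp [Set.Finite.mem_toFinset, Set.smul_mem_smul_set_iff]

variable (g : G)

/-- The orbit vector of the `K`-orbit of `gK` is `K`-fixed. -/
theorem orbitVector_orbit_mem_invariants [Finite (orbit K (g : G ⧸ K))] :
    orbitVector k K (orbit K (g : G ⧸ K)) ∈ invariants (ofMulAction k G (G ⧸ K)) K := by
  rw [mem_invariants_iff]
  intro κ hκ
  rw [ofMulAction_orbitVector k K (Set.toFinite _) κ]
  congr 1
  exact smul_orbit (⟨κ, hκ⟩ : K) (g : G ⧸ K)

/-- THE DOUBLE-COSET ELEMENT `T_g = 1_{KgK} ∈ H(G, K)`: the `G`-endomorphism of `k[G ⧸ K]` sending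
`δ_K` to the orbit vector of `KgK/K` (Frobenius reciprocity for `V = k[G ⧸ K]`). -/
def doubleCosetOp [Finite (orbit K (g : G ⧸ K))] : heckeAlgebra k K :=
  (heckeAlgebraEquivInvariants (k := k) (K := K)).symm
    ⟨orbitVector k K (orbit K (g : G ⧸ K)), orbitVector_orbit_mem_invariants k K g⟩

/-- `T_g` sends `δ_K` to the orbit vector of `KgK/K`. -/
theorem doubleCosetOp_apply_single_one [Finite (orbit K (g : G ⧸ K))] :
    (doubleCosetOp k K g).1 (single ((1 : G) : G ⧸ K) 1) = orbitVector k K (orbit K (g : G ⧸ K)) := by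
  rw [← heckeAlgebraEquivInvariants_apply, doubleCosetOp, LinearEquiv.apply_symm_apply]

/-- `T_g` depends only on the `K`-orbit of `gK`. -/
theorem doubleCosetOp_eq_of_orbit_eq {g g' : G} [Finite (orbit K (g : G ⧸ K))]
    [Finite (orbit K (g' : G ⧸ K))] (h : orbit K (g : G ⧸ K) = orbit K (g' : G ⧸ K)) :
    doubleCosetOp k K g = doubleCosetOp k K g' := by
  unfold doubleCosetOp
  congr 1
  exact Subtype.ext (by simp only; rw [h])

/-- `T_g` depends only on the double coset `KgK`. -/
theorem doubleCosetOp_mul_mul {κ₁ κ₂ : G} (h₁ : κ₁ ∈ K) (h₂ : κ₂ ∈ K)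
    [Finite (orbit K (g : G ⧸ K))] [Finite (orbit K ((κ₁ * g * κ₂ : G) : G ⧸ K))] :
    doubleCosetOp k K (κ₁ * g * κ₂) = doubleCosetOp k K g := by
  apply doubleCosetOp_eq_of_orbit_eq
  have e1 : ((κ₁ * g * κ₂ : G) : G ⧸ K) = ((κ₁ * g : G) : G ⧸ K) := by
    rw [QuotientGroup.eq]
    have : (κ₁ * g * κ₂)⁻¹ * (κ₁ * g) = κ₂⁻¹ := by group
    rw [this]
    exact inv_mem h₂
  have e2 : ((κ₁ * g : G) : G ⧸ K) = (⟨κ₁, h₁⟩ : K) • (g : G ⧸ K) := rfl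
  rw [e1, e2, orbit_smul]

/-- For `g ∈ K` the `K`-orbit of `gK` is the single coset `K`. -/
theorem orbit_coset_of_mem {g : G} (hg : g ∈ K) :
    orbit K (g : G ⧸ K) = {((1 : G) : G ⧸ K)} := by
  have h1 : (g : G ⧸ K) = ((1 : G) : G ⧸ K) := QuotientGroup.eq.2 (by simpa using inv_mem hg)
  rw [h1]
  ext x
  simp only [Set.mem_singleton_iff, mem_orbit_iff]
  constructor
  · rintro ⟨κ, rfl⟩
    change (((κ : G) * 1 : G) : G ⧸ K) = ((1 : G) : G ⧸ K)
    exact QuotientGroup.eq.2 (by simp)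
  · rintro rfl
    exact ⟨1, one_smul _ _⟩

/-- `T_g = 1` for `g ∈ K`. -/
theorem doubleCosetOp_of_mem {g : G} (hg : g ∈ K) [Finite (orbit K (g : G ⧸ K))] :
    doubleCosetOp k K g = 1 := by
  apply (heckeAlgebraEquivInvariants (k := k) (K := K)).injective
  ext
  rw [heckeAlgebraEquivInvariants_apply, heckeAlgebraEquivInvariants_apply,
    doubleCosetOp_apply_single_one, orbit_coset_of_mem K hg, orbitVector_singleton]
  rfl

end OrbitVector

section Action

variable (ρ : Representation k G V) {K : Subgroup G} (g : G)

/-- `T_g • v = ∑_{x ∈ KgK/K} ρ(x) v` on `V^K`. -/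
theorem heckeSMul_doubleCosetOp [Finite (orbit K (g : G ⧸ K))] (v : invariants ρ K) :
    (heckeSMul ρ (doubleCosetOp k K g) v : V) =
      ∑ᶠ x ∈ orbit K (g : G ⧸ K), orbitMap ρ v.1 v.2 x := by
  rw [heckeSMul_coe, doubleCosetOp_apply_single_one, orbitVector,
    finsum_mem_eq_finite_toFinset_sum _ (Set.toFinite _), map_sum,
    finsum_mem_eq_finite_toFinset_sum _ (Set.toFinite _)]
  simp [orbitLinear_single]

/-- The coset sum of T5-35 over the stabiliser of `gK`, applied to `ρ g v`, is the sum of `ρ(x) v`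
over the `K`-orbit of `gK`. -/
theorem cosetSum_stabilizer_coset [Finite (orbit K (g : G ⧸ K))] {v : V}
    (hv : v ∈ invariants ρ K) :
    cosetSum ρ (stabilizer K (g : G ⧸ K)) (ρ g v) =
      ∑ᶠ x ∈ orbit K (g : G ⧸ K), orbitMap ρ v hv x := by
  rw [← finsum_set_coe_eq_finsum_mem]
  unfold cosetSum
  symm
  refine finsum_eq_of_bijective (orbitEquivQuotientStabilizer K (g : G ⧸ K))
    (orbitEquivQuotientStabilizer K (g : G ⧸ K)).bijective (fun x => ?_)
  set c := orbitEquivQuotientStabilizer K (g : G ⧸ K) x with hc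
  have hx : (x : G ⧸ K) = (Quotient.out c : K) • (g : G ⧸ K) := by
    rw [← orbitEquivQuotientStabilizer_symm_apply K (g : G ⧸ K) (Quotient.out c),
      QuotientGroup.out_eq', hc, Equiv.symm_apply_apply]
  rw [hx]
  change orbitMap ρ v hv ((((Quotient.out c : K) : G) * g : G) : G ⧸ K) = _
  rw [orbitMap_mk, map_mul, Module.End.mul_apply]

/-- THE IDENTIFICATION: `e_K ρ(g) e_K = [K : K ∩ gKg⁻¹]⁻¹ · T_g` on `V^K` (characteristic `0`,
`ρ` `K`-finite, `KgK/K` finite). -/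
theorem heckeOp_eq_inv_index_smul [CharZero k] (hK : KFinite ρ K)
    [Finite (orbit K (g : G ⧸ K))] (v : invariants ρ K) :
    heckeOp ρ hK g v =
      ((stabilizer K (g : G ⧸ K)).index : k)⁻¹ • heckeSMul ρ (doubleCosetOp k K g) v := by
  haveI := finiteIndex_stabilizer_coset K g
  have h0 : ((stabilizer K (g : G ⧸ K)).index : k) ≠ 0 :=
    Nat.cast_ne_zero.2 Subgroup.FiniteIndex.index_ne_zero
  ext
  rw [heckeOp_apply, Submodule.coe_smul, heckeSMul_doubleCosetOp, ← cosetSum_stabilizer_coset ρ g v.2,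
    levelAverage_eq (stabilizer_coset_le_stabilizerIn K g ρ v.2) h0]

/-- THE IDENTIFICATION, counted: `e_K ρ(g) e_K = #(KgK/K)⁻¹ · T_g` on `V^K` — the Haar-free form of
`vol(K)⁻¹ 1_{KgK}` with `vol(KgK)/vol(K) = #(KgK/K)`. -/
theorem heckeOp_eq_inv_ncard_smul [CharZero k] (hK : KFinite ρ K)
    [Finite (orbit K (g : G ⧸ K))] (v : invariants ρ K) :
    heckeOp ρ hK g v =
      ((orbit K (g : G ⧸ K)).ncard : k)⁻¹ • heckeSMul ρ (doubleCosetOp k K g) v := by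
  rw [heckeOp_eq_inv_index_smul, index_stabilizer]

/-- `e_K ρ(g) e_K v = #(KgK/K)⁻¹ ∑_{x ∈ KgK/K} ρ(x) v` for `v ∈ V^K`. -/
theorem coe_heckeOp_eq_finsum [CharZero k] (hK : KFinite ρ K)
    [Finite (orbit K (g : G ⧸ K))] (v : invariants ρ K) :
    (heckeOp ρ hK g v : V) =
      ((orbit K (g : G ⧸ K)).ncard : k)⁻¹ • ∑ᶠ x ∈ orbit K (g : G ⧸ K), orbitMap ρ v.1 v.2 x := by
  rw [heckeOp_eq_inv_ncard_smul, Submodule.coe_smul, heckeSMul_doubleCosetOp]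

end Action

end

end Summit.Ventures.HodgeRepro2.T5HeckeDoubleCoset
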